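import Literature.AnabelianGeometry.EtaleTheta.FrobenioidMonoTheta
import Literature.AnabelianGeometry.EtaleTheta.Discharge.Sec5Cor512UniversalClosureRefuted

/-!
# [EtTh] §5 pp.330–334: seven more universal closures over the DATA-ONLY §5 interface are FALSE
# (kernel countermodels; FACT-LIST rows F-0737, F-0738, F-0543, F-0537, F-0542, F-0540, F-0541 — R5 «named instances only»)

Mochizuki, *The étale theta function and its Frobenioid-theoretic manifestations*, Publ. RIMS **45** (2009),
§5 pp.330–334 (PDF pp.104–108) [cite: MochizukiEtTh2009, §5 p.330 (PDF p.104)].  Cell abc-iut, block F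
(fact-proving wave), seat abc-iut-f-112 (FLOAT onto the unseated tranches 121/122/127); PROOF-ONLY companion of
abc-iut-L2-t4's `FrobenioidMonoTheta.lean` / `FrobenioidThetaBiKummer.lean`.  No new `Prop` fact, no edit of a
statement file; the only definitions are toy data.

WHAT IS PROVED.  The named §5 statements below are PREDICATES on `𝔉 : ThetaFrobenioid C D` (the tree's
`PreFrobenioidData` + §5 extras, DATA ONLY).  Their universal closures are refuted by a second toy family
`toyTheta' J j : ThetaFrobenioid (Discrete J × SingleObj ℤ/2) (SingleObj ℤ/2)` (all universes `0`): base functor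
CONSTANT to the one object `⋆` of `D := SingleObj ℤ/2`, so that `Aut_D(B_N^bs) = ℤ/2` while `Aut_C(B_N) → Aut_D(B_N^bs)`
is trivial; `Π^tp_X := ℤ × (ℤ/2 × ℤ/2)` (discrete) ↠ `ℤ`, `Π^tp_Ÿ :=` the last factor (index `2` in the kernel),
`ρ :=` the last factor onto `Aut_D(⋆)`, so `H_{B_N} = Im(Π^tp_Y) = Aut_D(⋆) = ℤ/2`; `s^⊓-gp_N := 1`, `s^⊔-gp_N :=` the
identification `H_{B_N} = ℤ/2 = ` the units of `B_N`; all Frobenius degrees `1`, all divisors trivial; `N := 2`,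
`K := 𝔽₂`, `O^×(−^birat) := ℤ/2`.
* F-0737 `AutAmpleBN`, F-0738 `SgpCapSection`, F-0543 `SgpCupSection`, F-0537 `ENExact` fail at `toyTheta'`
  (the generator of `Aut_D(⋆)` is not a value of the trivial map `Aut_C(B_N) → Aut_D(B_N^bs)`);
* F-0542 `SectionsFactor` fails at `{toyTheta' with N := 1}` (`E_N = 1` but `s^⊔-gp_N` hits the unit of order `2`);
* F-0540 `PreservesIsoClasses` fails at `toyTheta' Bool true` for the self-equivalence swapping the two points;
* F-0541 `PsiAutPreserves` fails at `{toyTheta' with O^×(−^birat) := ℤ/2 × ℤ/2}` for `Ψ = 𝟭`, `β = 𝟙` and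
  `Ψ^birat_Aut :=` the factor swap (the clause "`Ψ^birat_Aut` restricts to `Ψ^Aut` on `O^×(B_N)`").
WHAT THIS MEANS (R5).  These rows are hypotheses on the NAMED §5 data (in print they follow from [FrdI] Prop. 5.6,
Prop. 4.3 (iii), the Aut-ampleness of `B_N` p.330, Lemma 5.9, Thm. 5.10 (i)(ii) FOR THE TEMPERED FROBENIOID OF `Ÿ`),
never theorems of the interface; the instance forms that stand are L2-t4's PROVED reductions
`sgpCapSection_of`, `sgpCupSection_of`, `enExact_of`, `sectionsFactor_of` and the bundle `ThetaFrobenioid.Facts`.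
HONEST FRAMING: toy data say nothing about the §5 Frobenioid or about [IUTchIII] Cor. 3.12; refuted-as-schema ≠
refuted-in-print; no side taken; typed ≠ proved.
-/

namespace Literature.AnabelianGeometry.EtaleTheta

namespace ThetaFrobenioid

namespace MonoThetaToy

open CategoryTheory
open Literature.AlgebraicGeometry.Frobenioids
open ConstantMultiple.Cor512Toy (Mm m0)

variable (J : Type) (j : J)

/-- The toy category `C' := Discrete J × SingleObj ℤ/2` (a set of points, each with automorphism group `ℤ/2`).
[cite: MochizukiEtTh2009, §5 p.330 (PDF p.104)] -/
abbrev TC' : Type := Discrete J × SingleObj Mm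

/-- The toy base category `D' := SingleObj ℤ/2` (one object `⋆` with `Aut_D(⋆) = ℤ/2`).
[cite: MochizukiEtTh2009, §5 p.330 (PDF p.104)] -/
abbrev TD' : Type := SingleObj Mm

/-- The object `(j, ⋆)` (plays `A_⊚ = A_N = B_N`). [cite: MochizukiEtTh2009, §5 p.330 (PDF p.104)] -/
abbrev obj : TC' J := (⟨j⟩, SingleObj.star Mm)

/-- `ℤ/2 → Aut_D(⋆)`, `m ↦ (m, m⁻¹)`. [cite: MochizukiEtTh2009, §5 p.331 (PDF p.105)] -/
def toAutStar : Mm →* Aut (SingleObj.star Mm) where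
  toFun m := ⟨m, (m⁻¹ : Mm), inv_mul_cancel m, mul_inv_cancel m⟩
  map_one' := Aut.ext rfl
  map_mul' _ _ := Aut.ext rfl

/-- `Aut_D(⋆) → ℤ/2`, `a ↦ a.hom`. [cite: MochizukiEtTh2009, §5 p.331 (PDF p.105)] -/
def autStarToM : Aut (SingleObj.star Mm) →* Mm where
  toFun a := a.hom
  map_one' := rfl
  map_mul' _ _ := rfl

/-- The generator of `Aut_D(⋆)` is not the identity. [cite: MochizukiEtTh2009, §5 p.330 (PDF p.104)] -/
theorem toAutStar_m0_ne_one : toAutStar m0 ≠ 1 := fun h => by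
  have h' : m0 = (1 : Mm) := congrArg Iso.hom h
  exact absurd h' (by decide)

/-- `Aut_C(S) → ℤ/2`, the `SingleObj` coordinate of an automorphism (plays `O^×(S) ↪ O^×(S^birat)`).
[cite: MochizukiEtTh2009, §5 p.331 (PDF p.105)] -/
def autToM' (S : TC' J) : Aut S →* Mm where
  toFun a := a.hom.2
  map_one' := rfl
  map_mul' _ _ := rfl

/-- `ℤ/2 → Aut_C((j, ⋆))`, `m ↦ ((𝟙, m), (𝟙, m⁻¹))`. [cite: MochizukiEtTh2009, §5 p.331 (PDF p.105)] -/
def toAutObj : Mm →* Aut (obj J j) where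
  toFun m := ⟨(𝟙 _, m), (𝟙 _, (m⁻¹ : Mm)), Prod.ext (Subsingleton.elim _ _) (inv_mul_cancel m),
    Prod.ext (Subsingleton.elim _ _) (mul_inv_cancel m)⟩
  map_one' := Aut.ext rfl
  map_mul' _ _ := Aut.ext (Prod.ext (Subsingleton.elim _ _) rfl)

/-- The unit of order `2` of `(j, ⋆)` is not the identity. [cite: MochizukiEtTh2009, §5 p.330 (PDF p.104)] -/
theorem toAutObj_m0_ne_one : toAutObj J j m0 ≠ 1 := fun h => by
  have h' : m0 = (1 : Mm) := congrArg (fun a => a.hom.2) h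
  exact absurd h' (by decide)

/-- Automorphism groups of `C'` are commutative. [cite: MochizukiEtTh2009, §5 p.330 (PDF p.104)] -/
theorem aut_mul_comm' (S : TC' J) (a b : Aut S) : a * b = b * a := by
  apply Aut.ext
  change (b.hom ≫ a.hom) = (a.hom ≫ b.hom)
  refine Prod.ext (Subsingleton.elim _ _) ?_
  exact @mul_comm Mm _ a.hom.2 b.hom.2

/-- The toy pre-Frobenioid data: constant base `⋆`, trivial divisors, all Frobenius degrees `1`.
[cite: MochizukiEtTh2009, §5 p.330 (PDF p.104)] -/
def toyPre' : PreFrobenioidData.{0} (TC' J) TD' where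
  base := (Functor.const (TC' J)).obj (SingleObj.star Mm)
  Mon := fun _ => Unit
  pull := fun _ => MonoidHom.id Unit
  pull_id := fun _ _ => rfl
  pull_comp := fun _ _ _ => rfl
  div := fun _ => ()
  degFr := fun _ => 1
  div_id := fun _ => rfl
  div_comp := fun _ _ => rfl
  degFr_id := fun _ => rfl
  degFr_comp := fun _ _ => (one_mul 1).symm

/-- The toy `TemperedFrobenioidStub`: `O^×(S^birat) := ℤ/2`, units read through their `SingleObj` coordinate.
[cite: MochizukiEtTh2009, §5 p.331 (PDF p.105)] -/
def toyStub' : FrobenioidTheta.TemperedFrobenioidStub.{0} (TC' J) TD' where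
  pre := toyPre' J
  units_comm S := ⟨⟨fun a b => Subtype.ext (aut_mul_comm' J S a.1 b.1)⟩⟩
  biratUnits := fun _ => Mm
  unitsToBirat S := (autToM' J S).comp ((toyPre' J).unitsSubgroup S).subtype
  unitsToBirat_injective S := by
    intro a b h
    apply Subtype.ext
    apply Aut.ext
    exact Prod.ext (Subsingleton.elim _ _) h
  unitsPull := fun _ => 1
  IsBaseFrobeniusType := ⊤

/-- The toy `Π^tp_X := ℤ × (ℤ/2 × ℤ/2)`. [cite: MochizukiEtTh2009, §5 p.330 (PDF p.104)] -/
abbrev PiX' : Type := Multiplicative ℤ × (Mm × Mm)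

/-- The middle factor `Π^tp_X → ℤ/2` (its kernel inside `Π^tp_Y` is `Π^tp_Ÿ`). [cite: MochizukiEtTh2009, §5 p.332 (PDF p.106)] -/
def piMid : PiX' →* Mm := (MonoidHom.fst Mm Mm).comp (MonoidHom.snd (Multiplicative ℤ) (Mm × Mm))

/-- The last factor `Π^tp_X → ℤ/2 = Aut_D(⋆)` (plays `ρ : Π^tp_X ↠ Aut_D(B_N^bs)`). [cite: MochizukiEtTh2009, §5 p.331 (PDF p.105)] -/
def rhoToy : PiX' →* Aut (SingleObj.star Mm) :=
  toAutStar.comp ((MonoidHom.snd Mm Mm).comp (MonoidHom.snd (Multiplicative ℤ) (Mm × Mm)))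

/-- `Ker(pr₁ : Π^tp_X → ℤ)` maps ONTO `ℤ/2` under the middle factor. [cite: MochizukiEtTh2009, §5 p.332 (PDF p.106)] -/
theorem map_piMid_ker_fst :
    ((MonoidHom.fst (Multiplicative ℤ) (Mm × Mm)).ker).map piMid = ⊤ := by
  refine top_le_iff.mp fun m _ => ?_
  exact ⟨(1, (m, 1)), (MonoidHom.mem_ker).mpr rfl, rfl⟩

/-- **The second toy §5 datum** `toyTheta' J j : ThetaFrobenioid C' D'` (every field of the DATA-ONLY interface
supplied; see the module docstring for the values).  [cite: MochizukiEtTh2009, §5 pp.330–331 (PDF pp.104–105)] -/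
def toyTheta' : ThetaFrobenioid.{0} (TC' J) TD' where
  toTemperedFrobenioidStub := toyStub' J
  lDelta := fun _ => Unit
  lDeltaMap := fun _ => MonoidHom.id Unit
  l := 1
  odd_l := odd_one
  N := 2
  Acirc := obj J j
  AN := obj J j
  BN := obj J j
  sCap := 𝟙 _
  sCup := 𝟙 _
  base_map_sCap := rfl
  isPreStep_sCap := ⟨rfl, by change IsIso (𝟙 _); infer_instance⟩
  isPreStep_sCup := ⟨rfl, by change IsIso (𝟙 _); infer_instance⟩
  PiX := PiX'
  zquot := MonoidHom.fst _ _
  zquot_surjective := fun z => ⟨(z, 1), rfl⟩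
  PiYdd := piMid.ker ⊓ (MonoidHom.fst (Multiplicative ℤ) (Mm × Mm)).ker
  PiYdd_le := inf_le_right
  relindex_PiYdd := by
    rw [Subgroup.inf_relIndex_right, Subgroup.relIndex_ker, map_piMid_ker_fst, Subgroup.card_top,
      Nat.card_congr Multiplicative.toAdd, Nat.card_zmod]
  PiYdd_normal := inferInstance
  isOpen_PiYdd := isOpen_discrete _
  ρ := rhoToy
  ρ_surjective := fun a => ⟨(1, (1, a.hom)), Aut.ext rfl⟩
  isOpen_ker_ρ := isOpen_discrete _
  strv := 1
  sgpCap := 1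
  sgpCup := (toAutObj J j).comp (autStarToM.comp (Subgroup.subtype _))
  K := ZMod 2
  constEmb := 1
  constEmb_injective := by
    intro a b _
    have h : ∀ u : (ZMod 2)ˣ, u = 1 := by decide
    rw [h a, h b]
  thetaFn := (1 : Mm)

/-- `Aut_C(S) → Aut_D(S^bs)` is TRIVIAL in the toy datum (constant base functor).
[cite: MochizukiEtTh2009, §5 p.331 (PDF p.105)] -/
theorem autBase_eq_one (S : TC' J) (a : Aut S) : (toyTheta' J j).autBase S a = 1 := Aut.ext rfl

/-- The generator of `Aut_D(⋆)` lies in `H_{B_N}` (image of `(1, (1, m₀)) ∈ Π^tp_Ÿ`).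
[cite: MochizukiEtTh2009, §5 p.331 (PDF p.105)] -/
theorem toAutStar_m0_mem_HB : toAutStar m0 ∈ (toyTheta' J j).HB :=
  ⟨(1, (1, m0)), ⟨(MonoidHom.mem_ker).mpr rfl, (MonoidHom.mem_ker).mpr rfl⟩, rfl⟩

/-- The generator of `Aut_D(⋆)` lies in `Im(Π^tp_Y)`. [cite: MochizukiEtTh2009, Lem 5.9 (ii) p.332 (PDF p.106)] -/
theorem toAutStar_m0_mem_imPiY : toAutStar m0 ∈ (toyTheta' J j).imPiY :=
  ⟨(1, (1, m0)), (MonoidHom.mem_ker).mpr rfl, rfl⟩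

/-! ### F-0737 `AutAmpleBN`, F-0738 `SgpCapSection`, F-0543 `SgpCupSection`, F-0537 `ENExact` -/

/-- "`B_N` is Aut-ample" FAILS at the toy datum. [cite: MochizukiEtTh2009, §5 p.330 (PDF p.104)] -/
theorem not_autAmpleBN_toy : ¬ (toyTheta' J j).AutAmpleBN := by
  intro h
  obtain ⟨a, ha⟩ := h (toAutStar m0)
  rw [autBase_eq_one] at ha
  exact toAutStar_m0_ne_one ha.symm

/-- **F-0737: the universal closure of `ThetaFrobenioid.AutAmpleBN` is FALSE** (R5: named §5 data only; in print
p.330 (PDF p.104) "it follows that `B_N` is Aut-ample" for the tempered Frobenioid of `Ÿ`).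
[cite: MochizukiEtTh2009, §5 p.330 (PDF p.104)] -/
theorem not_forall_autAmpleBN :
    ¬ ∀ (C : Type) [Category.{0} C] (D : Type) [Category.{0} D] (𝔉 : ThetaFrobenioid.{0} C D), 𝔉.AutAmpleBN :=
  fun h => not_autAmpleBN_toy PUnit PUnit.unit (h _ _ (toyTheta' PUnit PUnit.unit))

/-- "`(s^⊓-gp_N(g))^bs = g`" FAILS at the toy datum (`s^⊓-gp_N := 1`, `Aut_D(⋆) ≠ 1`).
[cite: MochizukiEtTh2009, §5 p.331 (PDF p.105)] -/
theorem not_sgpCapSection_toy : ¬ (toyTheta' J j).SgpCapSection := by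
  intro h
  have ha := h (toAutStar m0)
  rw [autBase_eq_one] at ha
  exact toAutStar_m0_ne_one ha.symm

/-- **F-0738: the universal closure of `ThetaFrobenioid.SgpCapSection` is FALSE** (R5; instance form in tree:
`sgpCapSection_of` ⇐ `SgpCapSpec` + `StrvSection`).  [cite: MochizukiEtTh2009, §5 p.331 (PDF p.105)] -/
theorem not_forall_sgpCapSection :
    ¬ ∀ (C : Type) [Category.{0} C] (D : Type) [Category.{0} D] (𝔉 : ThetaFrobenioid.{0} C D), 𝔉.SgpCapSection :=
  fun h => not_sgpCapSection_toy PUnit PUnit.unit (h _ _ (toyTheta' PUnit PUnit.unit))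

/-- "`(s^⊔-gp_N(h))^bs = h`" FAILS at the toy datum (`H_{B_N} ∋` the generator, `Aut_C → Aut_D` trivial).
[cite: MochizukiEtTh2009, §5 p.331 (PDF p.105)] -/
theorem not_sgpCupSection_toy : ¬ (toyTheta' J j).SgpCupSection := by
  intro h
  have ha := h ⟨toAutStar m0, toAutStar_m0_mem_HB J j⟩
  rw [autBase_eq_one] at ha
  exact toAutStar_m0_ne_one ha.symm

/-- **F-0543: the universal closure of `ThetaFrobenioid.SgpCupSection` is FALSE** (R5; instance form in tree:
`sgpCupSection_of` ⇐ `SgpCapSection` + `BiKummerDifferenceMem`).  [cite: MochizukiEtTh2009, §5 p.331 (PDF p.105)] -/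
theorem not_forall_sgpCupSection :
    ¬ ∀ (C : Type) [Category.{0} C] (D : Type) [Category.{0} D] (𝔉 : ThetaFrobenioid.{0} C D), 𝔉.SgpCupSection :=
  fun h => not_sgpCupSection_toy PUnit PUnit.unit (h _ _ (toyTheta' PUnit PUnit.unit))

/-- Lemma 5.9 (ii) "`1 → μ_N(B_N) → E_N → Im(Π^tp_Y) → 1` exact" FAILS at the toy datum (`E_N` maps to `1`, but
`Im(Π^tp_Y) = ℤ/2`).  [cite: MochizukiEtTh2009, Lem 5.9 (ii) p.332 (PDF p.106)] -/
theorem not_enExact_toy : ¬ (toyTheta' J j).ENExact := by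
  intro h
  have hm : toAutStar m0 ∈ ((toyTheta' J j).EN).map ((toyTheta' J j).autBase (toyTheta' J j).BN) := by
    rw [h.1]
    exact toAutStar_m0_mem_imPiY J j
  obtain ⟨e, -, he⟩ := hm
  rw [autBase_eq_one] at he
  exact toAutStar_m0_ne_one he.symm

/-- **F-0537: the universal closure of `ThetaFrobenioid.ENExact` is FALSE** (R5; instance form in tree:
`enExact_of` ⇐ `SgpCapSection`).  [cite: MochizukiEtTh2009, Lem 5.9 (ii) p.332 (PDF p.106)] -/
theorem not_forall_enExact :
    ¬ ∀ (C : Type) [Category.{0} C] (D : Type) [Category.{0} D] (𝔉 : ThetaFrobenioid.{0} C D), 𝔉.ENExact :=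
  fun h => not_enExact_toy PUnit PUnit.unit (h _ _ (toyTheta' PUnit PUnit.unit))

/-! ### F-0542 `SectionsFactor` (Lemma 5.9 (i)) — the variant `N := 1` -/

/-- The toy datum with `N := 1` (so `μ_N(B_N) = 1` and `E_N = 1`). [cite: MochizukiEtTh2009, Lem 5.9 (i) p.331 (PDF p.105)] -/
def toyThetaN1 : ThetaFrobenioid.{0} (TC' J) TD' :=
  { toyTheta' J j with N := 1 }

/-- `E_N = 1` in the `N := 1` toy datum. [cite: MochizukiEtTh2009, §5 p.331 (PDF p.105)] -/
theorem EN_toyThetaN1_eq_bot : (toyThetaN1 J j).EN = ⊥ := by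
  refine le_bot_iff.mp (sup_le ?_ ?_)
  · rintro _ ⟨y, -, rfl⟩
    exact (Subgroup.mem_bot).mpr rfl
  · intro u hu
    have h1 : u ^ (((1 : ℕ+) : ℕ)) = 1 := hu.2
    rw [PNat.one_coe, pow_one] at h1
    exact (Subgroup.mem_bot).mpr h1

/-- Lemma 5.9 (i) "`s^⊔-gp_N` factors through `E_N`" FAILS at the `N := 1` toy datum (`s^⊔-gp_N` hits the unit of
order `2`, `E_N = 1`).  [cite: MochizukiEtTh2009, Lem 5.9 (i) p.331 (PDF p.105)] -/
theorem not_sectionsFactor_toy : ¬ (toyThetaN1 J j).SectionsFactor := by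
  intro h
  have hm := h.2 ⟨toAutStar m0, toAutStar_m0_mem_HB J j⟩
  rw [EN_toyThetaN1_eq_bot, Subgroup.mem_bot] at hm
  exact toAutObj_m0_ne_one J j hm

/-- **F-0542: the universal closure of `ThetaFrobenioid.SectionsFactor` is FALSE** (R5; instance form in tree:
`sectionsFactor_of` ⇐ `BiKummerDifferenceMem`).  [cite: MochizukiEtTh2009, Lem 5.9 (i) p.331 (PDF p.105)] -/
theorem not_forall_sectionsFactor :
    ¬ ∀ (C : Type) [Category.{0} C] (D : Type) [Category.{0} D] (𝔉 : ThetaFrobenioid.{0} C D), 𝔉.SectionsFactor :=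
  fun h => not_sectionsFactor_toy PUnit PUnit.unit (h _ _ (toyThetaN1 PUnit PUnit.unit))

/-! ### F-0540 `PreservesIsoClasses` (Theorem 5.10 (i)) — the variant `J := Bool` with the swap -/

/-- Negation as a permutation of `Bool`. [cite: MochizukiEtTh2009, Thm 5.10 (i) p.333 (PDF p.107)] -/
def boolNot : Bool ≃ Bool where
  toFun := not
  invFun := not
  left_inv := Bool.not_not
  right_inv := Bool.not_not

/-- The self-equivalence of `Discrete Bool × SingleObj ℤ/2` swapping the two points.
[cite: MochizukiEtTh2009, Thm 5.10 (i) p.333 (PDF p.107)] -/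
def swapEquiv : TC' Bool ≌ TC' Bool :=
  (Discrete.equivalence boolNot).prod (CategoryTheory.Equivalence.refl : SingleObj Mm ≌ SingleObj Mm)

/-- Theorem 5.10 (i) "`Ψ` preserves the isomorphism classes of `A_N`, `B_N`" FAILS for the swap at the toy datum
over `Bool` (`Ψ(A_N)` is the OTHER point).  [cite: MochizukiEtTh2009, Thm 5.10 (i) p.333 (PDF p.107)] -/
theorem not_preservesIsoClasses_toy : ¬ (toyTheta' Bool true).PreservesIsoClasses swapEquiv := by
  rintro ⟨⟨e⟩, -⟩
  have h : false = true := Discrete.eq_of_hom e.hom.1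
  exact Bool.false_ne_true h

/-- **F-0540: the universal closure of `ThetaFrobenioid.PreservesIsoClasses` is FALSE** (R5: a hypothesis on the
NAMED `Ψ` of Thm. 5.10, which in print follows from Cor. 3.8 / Thm. 4.4 for the tempered Frobenioid of `Ÿ`).
[cite: MochizukiEtTh2009, Thm 5.10 (i) p.333 (PDF p.107)] -/
theorem not_forall_preservesIsoClasses :
    ¬ ∀ (C : Type) [Category.{0} C] (D : Type) [Category.{0} D] (𝔉 : ThetaFrobenioid.{0} C D) (Ψ : C ≌ C),
        𝔉.PreservesIsoClasses Ψ :=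
  fun h => not_preservesIsoClasses_toy (h _ _ (toyTheta' Bool true) swapEquiv)

/-! ### F-0541 `PsiAutPreserves` (Theorem 5.10 (ii)) — the variant `O^×(−^birat) := ℤ/2 × ℤ/2` -/

/-- The toy datum with `O^×(−^birat) := ℤ/2 × ℤ/2`, units embedded in the FIRST factor, constants trivial.
[cite: MochizukiEtTh2009, Thm 5.10 (ii) p.333 (PDF p.107)] -/
def toyThetaBig : ThetaFrobenioid.{0} (TC' J) TD' :=
  { toyTheta' J j with
    biratUnits := fun _ => Mm × Mm
    instCommGroupBirat := fun _ => inferInstance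
    unitsToBirat := fun S => (MonoidHom.inl Mm Mm).comp ((autToM' J S).comp ((toyPre' J).unitsSubgroup S).subtype)
    unitsToBirat_injective := fun S => by
      intro a b h
      have h' : (autToM' J S a.1, (1 : Mm)) = (autToM' J S b.1, 1) := h
      apply Subtype.ext
      apply Aut.ext
      exact Prod.ext (Subsingleton.elim _ _) (congrArg Prod.fst h')
    constEmb := 1
    constEmb_injective := by
      intro a b _
      have h : ∀ u : (ZMod 2)ˣ, u = 1 := by decide
      rw [h a, h b]
    thetaFn := 1 }

/-- Theorem 5.10 (ii), clause "`Ψ^birat_Aut` restricts to `Ψ^Aut` on `O^×(B_N)`", FAILS at the big toy datum for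
`Ψ = 𝟭`, `β = 𝟙`, `Ψ^birat_Aut :=` the factor swap of `ℤ/2 × ℤ/2`.
[cite: MochizukiEtTh2009, Thm 5.10 (ii) p.333–334 (PDF pp.107–108)] -/
theorem not_psiAutPreserves_toy :
    ¬ (toyThetaBig J j).PsiAutPreserves (CategoryTheory.Equivalence.refl : TC' J ≌ TC' J) (Iso.refl _)
      MulEquiv.prodComm := by
  intro h
  obtain ⟨-, -, h3, -⟩ := h
  have hu : ∀ a : Aut (obj J j), a ∈ (toyThetaBig J j).units (toyThetaBig J j).BN := fun a => ⟨rfl, rfl⟩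
  have h4 := h3 ⟨toAutObj J j m0, hu _⟩ (hu _)
  have h5 : m0 = 1 := congrArg Prod.snd h4
  exact absurd h5 (by decide)

/-- **F-0541: the universal closure of `ThetaFrobenioid.PsiAutPreserves` is FALSE** (R5: a hypothesis on the NAMED
`Ψ`, `β`, `Ψ^birat_Aut` of Thm. 5.10 (ii); the parameter `Ψ^birat_Aut` is unconstrained data in the interface).
[cite: MochizukiEtTh2009, Thm 5.10 (ii) p.333–334 (PDF pp.107–108)] -/
theorem not_forall_psiAutPreserves :
    ¬ ∀ (C : Type) [Category.{0} C] (D : Type) [Category.{0} D] (𝔉 : ThetaFrobenioid.{0} C D) (Ψ : C ≌ C)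
        (β : Ψ.functor.obj 𝔉.BN ≅ 𝔉.BN) (ΨbiratAut : 𝔉.biratUnits 𝔉.BN ≃* 𝔉.biratUnits 𝔉.BN),
        𝔉.PsiAutPreserves Ψ β ΨbiratAut :=
  fun h => not_psiAutPreserves_toy PUnit PUnit.unit (h _ _ (toyThetaBig PUnit PUnit.unit) _ _ _)

end MonoThetaToy

end ThetaFrobenioid

end Literature.AnabelianGeometry.EtaleTheta
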